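import Summits.BirchSwinnertonDyer.BirchSwinnertonDyer.Theorems.UniversalToricDescentToricKernelAtThreeApZeroOddDefectPTOfPrint
import HarnessLib

/-!
# Route UniversalToricDescent — closer of act T's kernel‴ 27157 `ToricKernelAtThreeApZeroOddDefectPTTOfPrint`
# (kernel″ 26977 with the twin package ↦ the TORSION-CONDITIONAL package `TwinWanFrameAtThreeNonOrdBucketsT`)

Prover bsd-wall-utd-p2 g12 (`--workitem stmt-BirchSwinnertonDyer-27157`; pen pss3x g4's act T, route rev 47–48, certificate by
width seat utd-p2-w2 g3 `Cruxes/TwinSplitIMCAtThreeMult/Lines/ActF_TorsionConditionalTwin.lean` §2 `kernelF_proof`). The engine is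
ALREADY in the tree: w2 g3's p619971 `UniversalToricDescentKernelDefectPTOfPrint.bsdp_three_of_defectPT_of_nonOrdBucketsT_odd` — the
pointwise kernel on ♭T′ → wall → μ whose twin hypotheses are exactly the torsion-conditional ♭B_T / ♭C₀_T texts; the package
`TwinWanFrameAtThreeNonOrdBucketsT` is their verbatim conjunction, so `h3.1` / `h3.2` feed it. The printed leaves unpack as in
kernel″'s closer (PT ×2 feed the squeeze and the control; Yan–Zhu feeds bucket A; V♯ from LZZ + the E-port). THEOREM ONLY;
CONDITIONAL on nothing beyond the decl's own displayed hypotheses; BSD is not advanced by this file.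
-/

set_option autoImplicit false
-- `…BirchSwinnertonDyer.BirchSwinnertonDyer.Theorems…` is the problem's mandated namespace (D-0017).
set_option linter.dupNamespace false

namespace Summit.BirchSwinnertonDyer.BirchSwinnertonDyer.Theorems.UniversalToricDescentKernelDefectPTTOfPrint

open Summit.BirchSwinnertonDyer.BirchSwinnertonDyer.Theses.UniversalToricDescent
  Summit.BirchSwinnertonDyer.BirchSwinnertonDyer.Theorems
  Summit.BirchSwinnertonDyer.BirchSwinnertonDyer.Theorems.UniversalToricDescentKernelDefectPTOfPrint

/-- **Act T's kernel‴ `ToricKernelAtThreeApZeroOddDefectPTTOfPrint` (stmt-BirchSwinnertonDyer-27157) HOLDS** — the tree's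
torsion-conditional pointwise kernel + trichotomy `bsdp_three_of_defectPT_of_nonOrdBucketsT_odd` (p619971) fed the two conjuncts
of the package `TwinWanFrameAtThreeNonOrdBucketsT`, with the printed leaves unpacked exactly as in kernel″'s closer. The type is
literally the route decl of rev 47. [folklore] -/
theorem toricKernelAtThreeApZeroOddDefectPTTOfPrint_proof :
    Summit.BirchSwinnertonDyer.BirchSwinnertonDyer.Theses.UniversalToricDescent.ToricKernelAtThreeApZeroOddDefectPTTOfPrint := by
  intro hF hD hA hM h3 hsupply hW hS hL hZ
  obtain ⟨hYZ, h1, h2⟩ := hL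
  obtain ⟨hH, hB', hLZZ⟩ := hW
  exact bsdp_three_of_defectPT_of_nonOrdBucketsT_odd hF hD hA hM h1 h2 hYZ h3.1 h3.2
    (fun W _ _ hO6 hr hsurj htwin ↦ hsupply W hO6 hr hsurj htwin)
    (UniversalToricDescentKernelOdd.wildSplitWaldspurgerAtThreeOdd_of_lzz_of_frameOdd hLZZ (hS hH hB'))
    (UniversalToricDescentControl.wildSplitControlAtThree_of_poitouTate h1 h2) hZ

end Summit.BirchSwinnertonDyer.BirchSwinnertonDyer.Theorems.UniversalToricDescentKernelDefectPTTOfPrint
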